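import Summits.HodgeConjecture.HodgeConjecture.Theses.HeckePrymWeil
import Literature.AlgebraicGeometry.Motives.AbelianVarietyProjectiveChart

/-!
# `HyperbolicEightfoldsSqrtMinus7` (stmt-HodgeConjecture-14642) · Negative · kill propagation

Negative-side knowledge for the crux `HeckePrymWeil.HyperbolicEightfoldsSqrtMinus7` (split ℚ(√-7)-Weil
eightfolds), from the standing disprover's work file `Cruxes/HyperbolicEightfoldsSqrtMinus7/Disproof.lean` §1
(refuter-cdisprove-stmt-HodgeConjecture-14642-0, cycle 1, 2026-08-16).  All unconditional, pure logic over the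
route decls plus the tree's PROVED `AbelianVariety.isSmoothProjective_holds`.

WHAT IT CERTIFIES — why no refutation of this crux is to be expected, and what one would cost:

* `not_allDiscriminantEightfolds_of_not` : the crux is the restriction to the split component of the
  all-discriminant eightfold statement `HWA(7,4)` (inlined: every rational `(4,4)` class of the typed Weil plane
  of every `(A, φ)`, `A.dim = 8`, `φ ≫ φ = -7`, is algebraic); a kill of the crux kills `HWA(7,4)`;
* `not_hodgeConjecture_of_not` : … hence kills the Clay problem (abelian varieties are smooth projective);
* `not_hodgeWeilLadder_of_not` : … and, given the support `WeilDescending`, the route target `HodgeWeilLadder`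
  (rung `(7,3)` = dimension 12, then two descents `12 → 10 → 8`; `8` itself is not a rung dimension `6(g′-1)`);
* `not_weilTwelvefolds_of_not` : … and the sibling crux `WeilTwelvefoldsSqrtMinus7` (stmt-1261);
* `not_of_not_weilSixfolds` : conversely the crux is STRONGER than the parent it decides: with the lever
  `AimedDescending` at `(7,3)` it gives `WeilSixfoldsSqrtMinus7` (all discriminants), so a refutation of the
  parent propagates UP to the crux (re-verification of the planner's glue `weilSixfoldsSqrtMinus7_of_eightfolds`:
  the crux's hypothesis block unifies with the lever's antecedent, literal casts by `exact_mod_cast`).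

By André 1996 (catalogued barrier `Literature.Barriers.HodgeConjecture.Andre1996_hodgeClassesOnAbelianVarieties_motivated`)
a counterexample would moreover contradict the standard conjecture of Lefschetz type.  Nothing here asserts a
Theses decl positively.
-/

set_option linter.dupNamespace false

open CategoryTheory Complex
open Literature.AlgebraicGeometry Literature.AlgebraicGeometry.HodgeTheory

namespace Summit.HodgeConjecture.HodgeConjecture.Theorems.HyperbolicEightfoldsSqrtMinus7.Negative

open Summit.HodgeConjecture.HodgeConjecture.Theses.HeckePrymWeil

/-- **A kill of the crux kills the all-discriminant eightfold statement `HWA(7,4)`** (the crux is its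
restriction to hyperbolic triples: drop the binders `e, a` and the hyperbolicity hypothesis). [folklore] -/
theorem not_allDiscriminantEightfolds_of_not (h : ¬ HyperbolicEightfoldsSqrtMinus7) :
    ¬ ∀ (A : Motives.AbelianVariety ℂ) (φ : A ⟶ A), A.dim = 8 → φ ≫ φ = -((7 : ℤ) • 𝟙 A) →
      ∀ c : complexBetti A.X 8, IsRationalClass c → IsOfHodgeType 8 A.X 8 4 4 c →
        c ∈ Module.End.eigenspace (complexBetti.map (𝟙 A + φ).hom.hom.hom 8).hom
              ((1 + I * (Real.sqrt (7 : ℝ) : ℂ)) ^ 8) ⊔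
            Module.End.eigenspace (complexBetti.map (𝟙 A + φ).hom.hom.hom 8).hom
              ((1 - I * (Real.sqrt (7 : ℝ) : ℂ)) ^ 8) →
        c ∈ algebraicClasses A.X 4 :=
  fun h8 => h fun A φ hdim hφ _ _ _ _ _ c hr hH hW => h8 A φ hdim hφ c hr hH hW

/-- **Summit-hardness of refutation (unconditional)**: abelian varieties are smooth projective of dimension
`dim A` (the tree's proved `AbelianVariety.isSmoothProjective_holds`), so `HodgeConjecture` implies the crux;
any refutation of `HyperbolicEightfoldsSqrtMinus7` refutes the Clay problem. [folklore] -/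
theorem not_hodgeConjecture_of_not (h : ¬ HyperbolicEightfoldsSqrtMinus7) : ¬ _root_.HodgeConjecture := by
  intro hHC
  apply not_allDiscriminantEightfolds_of_not h
  intro A φ hdim _ c hr hH _
  have hsp : Motives.IsSmoothProjective 8 A.X := by
    have h' := (Motives.AbelianVariety.isSmoothProjective_holds (A := A))
    rw [Motives.AbelianVariety.isSmoothProjective, hdim] at h'
    exact h'
  exact (hHC hsp).2 4 c hr hH

/-- **A kill of the crux kills the route target** (given the support `WeilDescending`): rung `(p, g′) = (7, 3)`
of `HodgeWeilLadder` is dimension `12`; descend `12 → 10 → 8`. [folklore] -/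
theorem not_hodgeWeilLadder_of_not (h : ¬ HyperbolicEightfoldsSqrtMinus7) (hD : WeilDescending) :
    ¬ HodgeWeilLadder := by
  intro hL
  apply not_allDiscriminantEightfolds_of_not h
  intro A φ hdim hφ c hr hH hW
  have h12 := hL 7 (by norm_num) (by norm_num) (by norm_num) 3 (by norm_num) 6 (by norm_num)
  have h10 := hD 7 (by norm_num) (by norm_num) (by norm_num) 5 (by norm_num)
    (fun m hm => by subst hm; exact h12)
  have h8 := hD 7 (by norm_num) (by norm_num) (by norm_num) 4 (by norm_num)
    (fun m hm => by subst hm; exact h10)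
  have := h8 A φ hdim (by exact_mod_cast hφ) c hr hH
  exact this (by exact_mod_cast hW)

/-- **A kill of the crux kills the sibling crux `WeilTwelvefoldsSqrtMinus7`** (stmt-1261; given
`WeilDescending`): the twelvefold crux is rung `(7,3)` itself. [folklore] -/
theorem not_weilTwelvefolds_of_not (h : ¬ HyperbolicEightfoldsSqrtMinus7) (hD : WeilDescending) :
    ¬ WeilTwelvefoldsSqrtMinus7 := by
  intro h12
  apply not_allDiscriminantEightfolds_of_not h
  intro A φ hdim hφ c hr hH hW
  have h10 := hD 7 (by norm_num) (by norm_num) (by norm_num) 5 (by norm_num)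
    (fun m hm A' φ' hdim' hφ' c' hr' hH' hW' => by
      subst hm
      exact h12 A' φ' hdim' (by exact_mod_cast hφ') c' hr' hH' (by exact_mod_cast hW'))
  have h8 := hD 7 (by norm_num) (by norm_num) (by norm_num) 4 (by norm_num)
    (fun m hm => by subst hm; exact h10)
  have := h8 A φ hdim (by exact_mod_cast hφ) c hr hH
  exact this (by exact_mod_cast hW)

/-- **Upward propagation through the glue**: a refutation of the PARENT crux `WeilSixfoldsSqrtMinus7`
(all ℚ(√-7) sixfold discriminants) refutes, given the lever `AimedDescending`, the deciding child — the crux's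
hypothesis block is literally the antecedent of `AimedDescending` at `(p, n) = (7, 3)` (re-verification of the
planner's glue theorem; the child is stronger than its parent by design). [folklore] -/
theorem not_of_not_weilSixfolds (h6 : ¬ WeilSixfoldsSqrtMinus7) (hAD : AimedDescending) :
    ¬ HyperbolicEightfoldsSqrtMinus7 := by
  intro h8
  apply h6
  intro A φ hdim hφ c hr hH hW
  have h := hAD 7 (by norm_num) (by norm_num) (by norm_num) 3 (by norm_num)
    (fun m hm A' φ' hdim' hφ' e a ha ha0 hyp c' hr' hH' hW' => by
      subst hm
      exact h8 A' φ' hdim' (by exact_mod_cast hφ') e a ha ha0 (by exact_mod_cast hyp) c' hr' hH'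
        (by exact_mod_cast hW'))
  have := h A φ hdim (by exact_mod_cast hφ) c hr hH
  exact this (by exact_mod_cast hW)

end Summit.HodgeConjecture.HodgeConjecture.Theorems.HyperbolicEightfoldsSqrtMinus7.Negative
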